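/-
COR-CM (cell pub-hodgecm2, stage 2 of the Hodge ladder) — count-neutral KERNEL COMBINATORICS «field level of the SYLOW TRANSFER, II: Galois CM fields
whose Galois group has Sylow 2-subgroup ℤ/2ᵏ × ℤ/2 (k ≥ 2), or order 8·odd with abelian Sylow 2-subgroup, have EXACTLY φ₂(F) generating faces»
(seat prover-pub-hodgecm2-b23-g51-0, binder prover b23, gen 51; own census lane SYLOW TRANSFER, claim HOME/INBOX.md l.23329, blanket
`CorCM/FaceSylowTransfer*` l.23357).  Theorems only; `Census/SylowTransfer{Roots,EightOdd}.lean` (this seat), the field transfer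
`CorCM/FaceGenerationTransfer.lean` and the INT2-GEN socket are used BY NAME; nothing asserted.  `Interfaces.lean` (C1), every E term, B01,
`Transposition/*`, `PortJoin/*`, `D2Bridge/*` untouched.
HONEST FRAMING: `HC_CM` is NOT proved, here or anywhere in the tree; this file produces no period and proves no face period for any field; §2 is
CONDITIONAL on the face periods exactly as the earlier sockets.
T5: n/a-class (hypothesis binders: automorphisms `u₀, x₀` commuting, `ord u₀ = 2ᵏ`, `x₀² = 1`, `x₀ ∉ ⟨u₀⟩`, `[F:ℚ] = 2ᵏ⁺¹·m` with `m` odd `> 1` —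
inhabited by `ℚ(ζ₁₆)⁺(i)·k·L`-type fields; an abelian subgroup of `Aut(F)` of order `8` with `[F:ℚ] = 8·odd`; checker: self, 2026-08-25).
-/
import Summits.HodgeConjecture.CorCM.Census.SylowTransferEightOdd
import Summits.HodgeConjecture.CorCM.Census.SylowTransferTwoGroups
import Summits.HodgeConjecture.CorCM.FaceSylowTransfer
import HarnessLib

/-!
# Field level of the Sylow transfer, II: Sylow `ℤ/2ᵏ × ℤ/2` and order `8·odd` with abelian Sylow `2`-subgroup

* §1 **`isLeast_card_faces_hgen_of_aut_cyclicTimesTwo`**: a Galois CM field `F` of degree `2ᵏ⁺¹·m` (`m > 1` odd, `k ≥ 2`) with commuting automorphisms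
  `u₀` of order `2ᵏ` and an involution `x₀ ∉ ⟨u₀⟩` (so the Sylow `2`-subgroup of `Gal(F/ℚ)` is `ℤ/2ᵏ × ℤ/2`, complex conjugation ANY central
  involution) has EXACTLY `φ₂(F)` generating faces (`Census/SylowTransferRoots.lean`: Burnside transfer + seat b09ʼs roots law for the square
  involution, the coset sign for the others).
* §1 **`isLeast_card_faces_hgen_of_aut_eight_mul_odd_comm`**: a Galois CM field of degree `8·m` (`m` odd) whose automorphism group has an ABELIAN
  subgroup of order `8` has EXACTLY `φ₂(F)` generating faces (`Census/SylowTransferEightOdd.lean`; `m = 1`: gen 50ʼs order-`8` census).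
§2 records the CONDITIONAL Hodge-conjecture readings through the INT2-GEN socket; §3 (appendix) the element forms WITHOUT `m ≠ 1`
(`Census/SylowTransferTwoGroups.lean`).  `HC_CM` is NOT proved.

## References
* [Pohlmann1968] H. Pohlmann, Algebraic cycles on abelian varieties of complex multiplication type, Ann. of Math. 88 (1968), Thm 1.
* [Shimura1998] G. Shimura, Abelian Varieties with Complex Multiplication and Modular Functions, §6.2 Thm. 3, §8.1.
-/

noncomputable section

open CategoryTheory NumberField NumberField.ComplexEmbedding
open Literature.AlgebraicGeometry Literature.AlgebraicGeometry.Motives Literature.AlgebraicGeometry.HodgeTheory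
open Literature.AlgebraicGeometry.ComplexMultiplication Literature.AlgebraicGeometry.Milne1999
open Literature.NumberTheory.Automorphic
open Literature.NumberTheory.Automorphic.PicardCM
open Summit.HodgeConjecture.CorCM.Domination

namespace Summit.HodgeConjecture.CorCM.FaceSylowTransfer

open Summit.HodgeConjecture.CorCM.Prior.AllgGroup.RfwfAllgGroup
open Summit.HodgeConjecture.CorCM.Census.BlockParity
open Summit.HodgeConjecture.CorCM.Census.Coinvariant
open Summit.HodgeConjecture.CorCM.Census
open Summit.HodgeConjecture.CorCM.FaceCensus.OddSlice (galTOfAut galTOfAut_mul galTOfAut_conjAut)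

section Field

variable {F : Type} [Field F] [NumberField F]

/-! ## §1 Exactly `φ₂(F)` generating faces -/

/-- Transfer of an intrinsic `μ = φ₂` law on the Galois translates to the face sets of `F` (file-local wrapper of `CorCM/FaceGenerationTransfer.lean`).
[folklore] -/
private theorem isLeast_faces_of_isLeast_gfaces' [IsCMField F] [IsGalois ℚ F]
    (h : IsLeast {m : ℕ | ∃ S : Finset (CMF (GalT F) conjT →₀ ℤ), ↑S ⊆ gfaceSet (GalT F) conjT conjT_mul_self ∧ S.card = m ∧
      hodgeSpan (conjT : GalT F) conjT_mul_self ≤ Submodule.span ℤ (pairSet (conjT : GalT F)) ⊔ Submodule.span ℤ (translates conjT S)}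
      (fibreTwo (conjT : GalT F) conjT_mul_self)) (σ₀ : F →+* ℂ) :
    IsLeast {m : ℕ | ∃ 𝒮 : Finset (Face F), 𝒮.card = m ∧
      ∀ f : Face F, lefChar f.corner (fun _ => ({σ₀} : Finset (F →+* ℂ))) ∈ AddSubgroup.closure
        {a : Asym F | ∃ g ∈ (𝒮 : Set (Face F)), ∃ σ : F →+* ℂ, a = lefChar g.corner (fun _ => ({σ} : Finset (F →+* ℂ)))}}
      (fibreTwo (conjT : GalT F) conjT_mul_self) := by
  refine FaceTransfer.isLeast_card_faces_hgen_of_intrinsic _ ?_ (fun S₀ hS₀ hS => ?_) σ₀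
  · obtain ⟨S, hS, hcard, hgen⟩ := h.1
    exact ⟨S, hS, hcard.le, hgen⟩
  · exact fibreTwo_le_card conjT conjT_mul_self FaceBasis.conjT_comm S₀ (Submodule.span ℤ (pairSet conjT)) le_rfl hS₀
      (fun y hy => hS (gfaceSet_subset_hodgeSpan conjT conjT_mul_self hy))

/-- **SYLOW `ℤ/2ᵏ × ℤ/2` ON THE GALOIS TRANSLATES ⟹ EXACTLY `φ₂(F)` GENERATING FACES**: `[F:ℚ] = 2ᵏ⁺¹·m` (`m > 1` odd, `k ≥ 2`), commuting `u, x : GalT F`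
with `ord u = 2ᵏ`, `x² = 1`, `x ≠ 1`, `x ∉ ⟨u⟩`; complex conjugation any central involution. [folklore] -/
theorem isLeast_card_faces_hgen_of_cyclicTimesTwo [IsCMField F] [IsGalois ℚ F] {k m : ℕ} (u x : GalT F) (hux : u * x = x * u)
    (hord : orderOf u = 2 ^ k) (hk : 2 ≤ k) (hx2 : x * x = 1) (hx1 : x ≠ 1) (hxu : x ∉ Subgroup.zpowers u)
    (hdeg : Module.finrank ℚ F = 2 ^ (k + 1) * m) (hm : Odd m) (hm1 : m ≠ 1) (σ₀ : F →+* ℂ) :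
    IsLeast {n : ℕ | ∃ 𝒮 : Finset (Face F), 𝒮.card = n ∧
      ∀ f : Face F, lefChar f.corner (fun _ => ({σ₀} : Finset (F →+* ℂ))) ∈ AddSubgroup.closure
        {a : Asym F | ∃ g ∈ (𝒮 : Set (Face F)), ∃ σ : F →+* ℂ, a = lefChar g.corner (fun _ => ({σ} : Finset (F →+* ℂ)))}}
      (fibreTwo (conjT : GalT F) conjT_mul_self) :=
  isLeast_faces_of_isLeast_gfaces' (SylowTransfer.isLeast_card_gfaces_generate_fibreTwo_of_cyclicTimesTwo_elements conjT hux hord hk hx2 hx1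
    hxu ((FaceCensus.card_galT (F := F)).trans hdeg) hm hm1 conjT_mul_self conjT_ne_one FaceBasis.conjT_comm) σ₀

/-- **… automorphism form**: commuting `u₀, x₀ ∈ Aut(F)` with `ord u₀ = 2ᵏ`, `x₀² = 1`, `x₀ ≠ 1`, `x₀ ∉ ⟨u₀⟩`, `[F:ℚ] = 2ᵏ⁺¹·m`, `m > 1` odd, `k ≥ 2`
(e.g. `F = K·k·L`: `K` cyclic Galois CM of degree `2ᵏ`, `k` real quadratic, `L` totally real of odd degree). [folklore] -/
theorem isLeast_card_faces_hgen_of_aut_cyclicTimesTwo [IsCMField F] [IsGalois ℚ F] (σ₀ : F →+* ℂ) {k m : ℕ} (u₀ x₀ : F ≃ₐ[ℚ] F)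
    (hux : u₀ * x₀ = x₀ * u₀) (hord : orderOf u₀ = 2 ^ k) (hk : 2 ≤ k) (hx2 : x₀ * x₀ = 1) (hx1 : x₀ ≠ 1) (hxu : x₀ ∉ Subgroup.zpowers u₀)
    (hdeg : Module.finrank ℚ F = 2 ^ (k + 1) * m) (hm : Odd m) (hm1 : m ≠ 1) :
    IsLeast {n : ℕ | ∃ 𝒮 : Finset (Face F), 𝒮.card = n ∧
      ∀ f : Face F, lefChar f.corner (fun _ => ({σ₀} : Finset (F →+* ℂ))) ∈ AddSubgroup.closure
        {a : Asym F | ∃ g ∈ (𝒮 : Set (Face F)), ∃ σ : F →+* ℂ, a = lefChar g.corner (fun _ => ({σ} : Finset (F →+* ℂ)))}}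
      (fibreTwo (conjT : GalT F) conjT_mul_self) := by
  set e : (F ≃ₐ[ℚ] F) ≃* GalT F := MulEquiv.mk' (galTOfAut σ₀) (galTOfAut_mul σ₀) with he
  have hord' : orderOf (e u₀) = 2 ^ k := by rw [← hord]; exact orderOf_injective e.toMonoidHom e.injective u₀
  have hux' : e u₀ * e x₀ = e x₀ * e u₀ := by rw [← map_mul, ← map_mul, hux]
  have hx2' : e x₀ * e x₀ = 1 := by rw [← map_mul, hx2, map_one]
  have hx1' : e x₀ ≠ 1 := fun h => hx1 (by rwa [map_eq_one_iff _ e.injective] at h)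
  have hxu' : e x₀ ∉ Subgroup.zpowers (e u₀) := by
    rw [← MonoidHom.coe_coe, ← MonoidHom.map_zpowers]
    rintro ⟨y, hy, hye⟩
    exact hxu (by rwa [← e.injective hye])
  exact isLeast_card_faces_hgen_of_cyclicTimesTwo (e u₀) (e x₀) hux' hord' hk hx2' hx1' hxu' hdeg hm hm1 σ₀

/-- **ORDER `8·odd` WITH ABELIAN SYLOW `2`-SUBGROUP ⟹ EXACTLY `φ₂(F)` GENERATING FACES**: `[F:ℚ] = 8·m` (`m` odd) and an abelian subgroup of
`Aut(F)` of order `8`; complex conjugation any central involution. [folklore] -/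
theorem isLeast_card_faces_hgen_of_aut_eight_mul_odd_comm [IsCMField F] [IsGalois ℚ F] (σ₀ : F →+* ℂ) {m : ℕ}
    (hdeg : Module.finrank ℚ F = 8 * m) (hm : Odd m) (H : Subgroup (F ≃ₐ[ℚ] F)) (hH : Nat.card H = 8)
    (hcomm : ∀ a ∈ H, ∀ b ∈ H, a * b = b * a) :
    IsLeast {n : ℕ | ∃ 𝒮 : Finset (Face F), 𝒮.card = n ∧
      ∀ f : Face F, lefChar f.corner (fun _ => ({σ₀} : Finset (F →+* ℂ))) ∈ AddSubgroup.closure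
        {a : Asym F | ∃ g ∈ (𝒮 : Set (Face F)), ∃ σ : F →+* ℂ, a = lefChar g.corner (fun _ => ({σ} : Finset (F →+* ℂ)))}}
      (fibreTwo (conjT : GalT F) conjT_mul_self) := by
  haveI : Fact (Nat.Prime 2) := ⟨Nat.prime_two⟩
  set e : (F ≃ₐ[ℚ] F) ≃* GalT F := MulEquiv.mk' (galTOfAut σ₀) (galTOfAut_mul σ₀) with he
  have hcardG : Fintype.card (GalT F) = 8 * m := (FaceCensus.card_galT (F := F)).trans hdeg
  have hm0 : m ≠ 0 := fun h => by simp [h] at hm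
  have hcard : Nat.card (H.map (e : (F ≃ₐ[ℚ] F) →* GalT F)) = 2 ^ (Nat.card (GalT F)).factorization 2 := by
    rw [Subgroup.card_map_of_injective (by exact e.injective), hH, Nat.card_eq_fintype_card, hcardG, Nat.factorization_mul (by norm_num) hm0,
      Finsupp.add_apply, Nat.factorization_eq_zero_of_not_dvd hm.not_two_dvd_nat, add_zero, show (8 : ℕ) = 2 ^ 3 by norm_num,
      Nat.factorization_pow, Finsupp.smul_apply, smul_eq_mul, Nat.prime_two.factorization_self, mul_one]
  set P : Sylow 2 (GalT F) := Sylow.ofCard _ hcard with hP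
  have hcommP : ∀ a ∈ (P : Subgroup (GalT F)), ∀ b ∈ (P : Subgroup (GalT F)), a * b = b * a := by
    intro a ha b hb
    rw [hP, Sylow.coe_ofCard] at ha hb
    obtain ⟨a', ha', rfl⟩ := Subgroup.mem_map.mp ha
    obtain ⟨b', hb', rfl⟩ := Subgroup.mem_map.mp hb
    rw [MonoidHom.coe_coe, ← map_mul, ← map_mul, hcomm a' ha' b' hb']
  exact isLeast_faces_of_isLeast_gfaces' (SylowTransfer.isLeast_card_gfaces_generate_fibreTwo_of_card_eq_eight_mul_odd_comm' conjT hcardG hm P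
    hcommP conjT_mul_self conjT_ne_one FaceBasis.conjT_comm) σ₀

end Field

/-! ## §2 The Hodge-conjecture readings through the INT2-GEN socket (conditional on the face periods) -/

/-- **HC for the slice of a Galois CM field with Sylow `ℤ/2ᵏ × ℤ/2` (automorphism form), from `φ₂(K)` face periods** (CONDITIONAL; `HC_CM` is NOT
proved). [cite: Shimura1998, §6.2 Theorem 3 and §6.1 Corollary of Theorem 2 (pp. 41–43)] [cite: Pohlmann1968, Thm. 1]
[cite: Milne1999LefschetzClasses, Thm. 3.2 and Cor. 4.5] [cite: MumfordAV1970, §19 Thm. 1 and p. 169] -/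
theorem hodgeConjectureFor_of_aut_cyclicTimesTwo_of_exists_facePeriod (K : CMField) [hGal : IsGalois ℚ K] (σ₀ : (K : Type) →+* ℂ)
    {k m : ℕ} (u₀ x₀ : (K : Type) ≃ₐ[ℚ] (K : Type)) (hux : u₀ * x₀ = x₀ * u₀) (hord : orderOf u₀ = 2 ^ k) (hk : 2 ≤ k) (hx2 : x₀ * x₀ = 1)
    (hx1 : x₀ ≠ 1) (hxu : x₀ ∉ Subgroup.zpowers u₀) (hdeg : Module.finrank ℚ K = 2 ^ (k + 1) * m) (hm : Odd m) (hm1 : m ≠ 1) :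
    ∃ 𝒮 : Finset (Face K), 𝒮.card = fibreTwo (conjT : GalT K) conjT_mul_self ∧
      ((∀ f ∈ 𝒮, ∃ ι₁ : K →+* ℂ, f.Admissible ι₁ ∧ ∃ (V : HermSpace3 K ι₁) (σ : K →+* ℂ),
        (Model.picardCMUniverse exists_isReal_hodgeModel_holds hodgePQ_independent_of_hodgeModel_holds
          BallQuotient.ballQuotientUniformised_holds cmAbelianVarietyRealised_holds).PeriodNV ι₁ V K f.psi σ) →
      ∀ {P B : AbelianVariety ℂ}, AbelianVariety.IsProductOf (fun B : AbelianVariety ℂ =>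
        ∃ (E : Type) (_ : Field E) (_ : NumberField E) (_ : IsCMField E) (_ : E →+* (K : Type)) (Φ : CMType E)
          (ι : 𝓞 E →+* End B) (ϑ : E →+* Module.End ℂ (complexBetti B.X 1)),
          IsCMTypeRealisation Φ B ι ϑ) P →
      AVDominatedBy B P → HodgeConjectureFor B.dim B.X) := by
  obtain ⟨⟨𝒮, hcard, hgen⟩, -⟩ := isLeast_card_faces_hgen_of_aut_cyclicTimesTwo (F := K) σ₀ u₀ x₀ hux hord hk hx2 hx1 hxu hdeg hm hm1
  refine ⟨𝒮, hcard, fun h P B hP hB => ?_⟩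
  have h6 : 6 ≤ Module.finrank ℚ K := by
    rw [hdeg, pow_succ]
    have h4 : 4 ≤ 2 ^ k := by
      calc 4 = 2 ^ 2 := by norm_num
        _ ≤ 2 ^ k := Nat.pow_le_pow_right (by norm_num) hk
    have h1 : 1 ≤ m := Nat.pos_of_ne_zero fun h0 => by simp [h0] at hm
    nlinarith
  exact hodgeConjectureFor_of_avDominatedBy_isProductOf_of_exists_facePeriod_on K h6 (𝒮 : Set (Face K)) σ₀ hgen
    (fun f hf => h f (Finset.mem_coe.mp hf)) hP hB

/-- **HC for the slice of a Galois CM field of degree `8·odd ≥ 24` with abelian Sylow `2`-subgroup, from `φ₂(K)` face periods** (CONDITIONAL;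
`HC_CM` is NOT proved). [cite: Shimura1998, §6.2 Theorem 3 and §6.1 Corollary of Theorem 2 (pp. 41–43)] [cite: Pohlmann1968, Thm. 1]
[cite: Milne1999LefschetzClasses, Thm. 3.2 and Cor. 4.5] [cite: MumfordAV1970, §19 Thm. 1 and p. 169] -/
theorem hodgeConjectureFor_of_aut_eight_mul_odd_comm_of_exists_facePeriod (K : CMField) [hGal : IsGalois ℚ K] (σ₀ : (K : Type) →+* ℂ)
    {m : ℕ} (hdeg : Module.finrank ℚ K = 8 * m) (hm : Odd m) (H : Subgroup ((K : Type) ≃ₐ[ℚ] (K : Type))) (hH : Nat.card H = 8)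
    (hcomm : ∀ a ∈ H, ∀ b ∈ H, a * b = b * a) :
    ∃ 𝒮 : Finset (Face K), 𝒮.card = fibreTwo (conjT : GalT K) conjT_mul_self ∧
      ((∀ f ∈ 𝒮, ∃ ι₁ : K →+* ℂ, f.Admissible ι₁ ∧ ∃ (V : HermSpace3 K ι₁) (σ : K →+* ℂ),
        (Model.picardCMUniverse exists_isReal_hodgeModel_holds hodgePQ_independent_of_hodgeModel_holds
          BallQuotient.ballQuotientUniformised_holds cmAbelianVarietyRealised_holds).PeriodNV ι₁ V K f.psi σ) →
      ∀ {P B : AbelianVariety ℂ}, AbelianVariety.IsProductOf (fun B : AbelianVariety ℂ =>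
        ∃ (E : Type) (_ : Field E) (_ : NumberField E) (_ : IsCMField E) (_ : E →+* (K : Type)) (Φ : CMType E)
          (ι : 𝓞 E →+* End B) (ϑ : E →+* Module.End ℂ (complexBetti B.X 1)),
          IsCMTypeRealisation Φ B ι ϑ) P →
      AVDominatedBy B P → HodgeConjectureFor B.dim B.X) := by
  obtain ⟨⟨𝒮, hcard, hgen⟩, -⟩ := isLeast_card_faces_hgen_of_aut_eight_mul_odd_comm (F := K) σ₀ hdeg hm H hH hcomm
  refine ⟨𝒮, hcard, fun h P B hP hB => ?_⟩
  have h6 : 6 ≤ Module.finrank ℚ K := by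
    rw [hdeg]
    have h1 : 1 ≤ m := Nat.pos_of_ne_zero fun h0 => by simp [h0] at hm
    omega
  exact hodgeConjectureFor_of_avDominatedBy_isProductOf_of_exists_facePeriod_on K h6 (𝒮 : Set (Face K)) σ₀ hgen
    (fun f hf => h f (Finset.mem_coe.mp hf)) hP hB

/-! ## §3 Appendix (gen 51, same session): the element forms WITHOUT `m ≠ 1` (`Census/SylowTransferTwoGroups.lean`) -/

section FieldPrimed

variable {F : Type} [Field F] [NumberField F]

/-- **An automorphism of order the `2`-part `2ᵏ ≥ 4` of the degree ⟹ EXACTLY `φ₂(F)` generating faces** — `[F:ℚ] = 2ᵏ·m`, `m` odd (ANY `m`; `m = 1` is the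
cyclic field of degree `2ᵏ`). [folklore] -/
theorem isLeast_card_faces_hgen_of_aut_orderOf_eq_two_pow' [IsCMField F] [IsGalois ℚ F] (σ₀ : F →+* ℂ) {k m : ℕ} (u₀ : F ≃ₐ[ℚ] F)
    (hu₀ : orderOf u₀ = 2 ^ k) (hk : 2 ≤ k) (hdeg : Module.finrank ℚ F = 2 ^ k * m) (hm : Odd m) :
    IsLeast {n : ℕ | ∃ 𝒮 : Finset (Face F), 𝒮.card = n ∧
      ∀ f : Face F, lefChar f.corner (fun _ => ({σ₀} : Finset (F →+* ℂ))) ∈ AddSubgroup.closure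
        {a : Asym F | ∃ g ∈ (𝒮 : Set (Face F)), ∃ σ : F →+* ℂ, a = lefChar g.corner (fun _ => ({σ} : Finset (F →+* ℂ)))}}
      (fibreTwo (conjT : GalT F) conjT_mul_self) := by
  set e : (F ≃ₐ[ℚ] F) ≃* GalT F := MulEquiv.mk' (galTOfAut σ₀) (galTOfAut_mul σ₀) with he
  have hord : orderOf (e u₀) = 2 ^ k := by rw [← hu₀]; exact orderOf_injective e.toMonoidHom e.injective u₀
  exact isLeast_faces_of_isLeast_gfaces' (SylowTransfer.isLeast_card_gfaces_generate_fibreTwo_of_orderOf_eq_two_pow' conjT (e u₀) hord hk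
    ((FaceCensus.card_galT (F := F)).trans hdeg) hm conjT_mul_self conjT_ne_one FaceBasis.conjT_comm) σ₀

/-- **Commuting automorphisms `u₀` of order `2ᵏ` (`k ≥ 2`) and an involution `x₀ ∉ ⟨u₀⟩`, `[F:ℚ] = 2ᵏ⁺¹·m` with `m` odd (ANY `m`) ⟹ EXACTLY `φ₂(F)`
generating faces** (Sylow `ℤ/2ᵏ × ℤ/2`; `m = 1`: the abelian field `ℤ/2ᵏ × ℤ/2`). [folklore] -/
theorem isLeast_card_faces_hgen_of_aut_cyclicTimesTwo' [IsCMField F] [IsGalois ℚ F] (σ₀ : F →+* ℂ) {k m : ℕ} (u₀ x₀ : F ≃ₐ[ℚ] F)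
    (hux : u₀ * x₀ = x₀ * u₀) (hord : orderOf u₀ = 2 ^ k) (hk : 2 ≤ k) (hx2 : x₀ * x₀ = 1) (hx1 : x₀ ≠ 1) (hxu : x₀ ∉ Subgroup.zpowers u₀)
    (hdeg : Module.finrank ℚ F = 2 ^ (k + 1) * m) (hm : Odd m) :
    IsLeast {n : ℕ | ∃ 𝒮 : Finset (Face F), 𝒮.card = n ∧
      ∀ f : Face F, lefChar f.corner (fun _ => ({σ₀} : Finset (F →+* ℂ))) ∈ AddSubgroup.closure
        {a : Asym F | ∃ g ∈ (𝒮 : Set (Face F)), ∃ σ : F →+* ℂ, a = lefChar g.corner (fun _ => ({σ} : Finset (F →+* ℂ)))}}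
      (fibreTwo (conjT : GalT F) conjT_mul_self) := by
  set e : (F ≃ₐ[ℚ] F) ≃* GalT F := MulEquiv.mk' (galTOfAut σ₀) (galTOfAut_mul σ₀) with he
  have hord' : orderOf (e u₀) = 2 ^ k := by rw [← hord]; exact orderOf_injective e.toMonoidHom e.injective u₀
  have hux' : e u₀ * e x₀ = e x₀ * e u₀ := by rw [← map_mul, ← map_mul, hux]
  have hx2' : e x₀ * e x₀ = 1 := by rw [← map_mul, hx2, map_one]
  have hx1' : e x₀ ≠ 1 := fun h => hx1 (by rwa [map_eq_one_iff _ e.injective] at h)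
  have hxu' : e x₀ ∉ Subgroup.zpowers (e u₀) := by
    rw [← MonoidHom.coe_coe, ← MonoidHom.map_zpowers]
    rintro ⟨y, hy, hye⟩
    exact hxu (by rwa [← e.injective hye])
  exact isLeast_faces_of_isLeast_gfaces' (SylowTransfer.isLeast_card_gfaces_generate_fibreTwo_of_cyclicTimesTwo_elements' conjT hux' hord' hk hx2'
    hx1' hxu' ((FaceCensus.card_galT (F := F)).trans hdeg) hm conjT_mul_self conjT_ne_one FaceBasis.conjT_comm) σ₀

end FieldPrimed

/-- **HC for the slice of a Galois CM field of degree `2ᵏ⁺¹·m ≥ 6` (`m` odd, any) with Sylow `ℤ/2ᵏ × ℤ/2`, from `φ₂(K)` face periods** (CONDITIONAL;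
`HC_CM` is NOT proved). [cite: Shimura1998, §6.2 Theorem 3 and §6.1 Corollary of Theorem 2 (pp. 41–43)] [cite: Pohlmann1968, Thm. 1]
[cite: Milne1999LefschetzClasses, Thm. 3.2 and Cor. 4.5] [cite: MumfordAV1970, §19 Thm. 1 and p. 169] -/
theorem hodgeConjectureFor_of_aut_cyclicTimesTwo_of_exists_facePeriod' (K : CMField) [hGal : IsGalois ℚ K] (σ₀ : (K : Type) →+* ℂ)
    (h6 : 6 ≤ Module.finrank ℚ K) {k m : ℕ} (u₀ x₀ : (K : Type) ≃ₐ[ℚ] (K : Type)) (hux : u₀ * x₀ = x₀ * u₀) (hord : orderOf u₀ = 2 ^ k)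
    (hk : 2 ≤ k) (hx2 : x₀ * x₀ = 1) (hx1 : x₀ ≠ 1) (hxu : x₀ ∉ Subgroup.zpowers u₀) (hdeg : Module.finrank ℚ K = 2 ^ (k + 1) * m) (hm : Odd m) :
    ∃ 𝒮 : Finset (Face K), 𝒮.card = fibreTwo (conjT : GalT K) conjT_mul_self ∧
      ((∀ f ∈ 𝒮, ∃ ι₁ : K →+* ℂ, f.Admissible ι₁ ∧ ∃ (V : HermSpace3 K ι₁) (σ : K →+* ℂ),
        (Model.picardCMUniverse exists_isReal_hodgeModel_holds hodgePQ_independent_of_hodgeModel_holds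
          BallQuotient.ballQuotientUniformised_holds cmAbelianVarietyRealised_holds).PeriodNV ι₁ V K f.psi σ) →
      ∀ {P B : AbelianVariety ℂ}, AbelianVariety.IsProductOf (fun B : AbelianVariety ℂ =>
        ∃ (E : Type) (_ : Field E) (_ : NumberField E) (_ : IsCMField E) (_ : E →+* (K : Type)) (Φ : CMType E)
          (ι : 𝓞 E →+* End B) (ϑ : E →+* Module.End ℂ (complexBetti B.X 1)),
          IsCMTypeRealisation Φ B ι ϑ) P →
      AVDominatedBy B P → HodgeConjectureFor B.dim B.X) := by
  obtain ⟨⟨𝒮, hcard, hgen⟩, -⟩ := isLeast_card_faces_hgen_of_aut_cyclicTimesTwo' (F := K) σ₀ u₀ x₀ hux hord hk hx2 hx1 hxu hdeg hm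
  refine ⟨𝒮, hcard, fun h P B hP hB => ?_⟩
  exact hodgeConjectureFor_of_avDominatedBy_isProductOf_of_exists_facePeriod_on K h6 (𝒮 : Set (Face K)) σ₀ hgen
    (fun f hf => h f (Finset.mem_coe.mp hf)) hP hB

end Summit.HodgeConjecture.CorCM.FaceSylowTransfer
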